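import Literature.NumberTheory.Automorphic.Liu2021.Thm418AsPrinted
import Mathlib.Algebra.Category.Grp.Basic
import Mathlib.Algebra.Category.ModuleCat.Basic
import Mathlib.LinearAlgebra.Matrix.Charpoly.LinearMap
import Mathlib.LinearAlgebra.Matrix.GeneralLinearGroup.Defs
import Mathlib.Analysis.Calculus.Deriv.Basic
import Mathlib.Analysis.SpecialFunctions.Log.Basic
import HarnessLib

/-!
# Liu 2021, §1.3–§1.6 of the Introduction (print pp. 11–20: relative and arithmetic fundamental lemma for `U(n) × U(n)`,
# items 1.9–1.15) — SECTION CARPET (statement-exact typing over in-file hypothesis structures; no proof; predictions are VOCABULARY)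

[Liu2021] = Yifeng Liu, *Fourier–Jacobi cycles and arithmetic relative trace formula* (with an appendix by Chao Li and
Yihang Zhu), Cambridge J. Math. **9** (2021), no. 1, 1–147 = arXiv:2102.11518.  SOURCES READ: print text
`paper:liu2021-fourier-jacobi-cycles-arithmetic-relative-trace-formula` pp. 11–20 (page file `pNNNN` = journal page `N`) and, for the
symbols the extraction drops, the author's TeX `FJcycle.tex` (md5 `6db49a74122d…`) l. 848–1047.  Print = TeX numbering: 1.9 (p. 12 L38),
Rem. 1.10 (p. 13 L20), Def. 1.11 (p. 14 L19), 1.12 (p. 14 L34), Rem. 1.13 (p. 15 L5), Rem. 1.14 (p. 15 L12), 1.15 (p. 16 L9); §1.3 opens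
p. 11 L48, §1.4 p. 15 L18, §1.5 p. 17 L9, §1.6 p. 18 L19.  Dedup (2026-09-02): no tree declaration cites items 1.9–1.15 (green field).
Squad TL «GO 500», fourth block of TL-t02 (split of TL-t11's §1: §1.1–1.2 and §1.7 are `Sec1Introduction.lean`).
ED.2 (2026-09-02, squad retro-audit, L1 fix): `MatchingBijectionAsPrinted` gains the injectivity clause of «bijection» (two regular semisimple
`(ζ, y)`, `(ζ', y')` matching the same `(ξ, x)` are `GL_n(F)`-conjugate); all other declarations byte-identical.
ED.3 (2026-09-02, ERRATUM, DOC-ONLY — squad QA-20 (T-ref4, 03:30:31Z) decided by TL-plan RULING g2-3 (03:33:20Z), which SUPERSEDES the squad's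
earlier of-record ruling (02:41:42Z) for the §1.3 objects and for item 1.15): every statement of ED.2 is byte-identical; no declaration is added,
deleted or renamed; no attribute is added or removed.  What changes is the STATUS of the §1.3 / item-1.15 declarations — see the table below and
the leading «⚠ SUPERSEDED (QA-20)» line of each affected docstring.

## SUPERSEDED DECLS (QA-20 ∕ RULING g2-3)

The tree carries two typings of [Liu2021] §1.3 (items 1.9–1.14) and of item 1.15, landed minutes apart on 2026-09-02: THIS file (typer
TL-t02: a posited ⟨CARRIER⟩ dictionary `Sec13Data` — tokens `q`, `p`, `ordE`, `muEF`, `SchS`, `oneS`, `orb`, `V`, `U`, `herm`, `toEnd`,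
`intPlus`, `IsQp`, `ZhangAFL`, `IsMinuscule`, `pBound` — with REAL matrix-level notions over it) and typer TL-t11's three files ★
`Sec13RelativeFundamentalLemma.lean` ∕ ★ `Sec13ArithmeticFundamentalLemma.lean` ∕ ★ `Sec1Introduction.lean`, which CONSTRUCT what
`Sec13Data` posits: `AFLSetup` over Mathlib's `IsNonarchimedeanLocalField F ∕ E` + `ValuativeExtension F E` (char. `0`, `[E : F] = 2`,
unramified), `q = Nat.card 𝓀[F]`, `ord`, `μ_{E/F}` as `(−1)^{ord_E}` (`ℤˣ`-valued transfer factor), the sign `±` by the valuation-parity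
criterion, hermitian spaces `HermSpaceLoc` in coordinates with ★ `unitaryGroup`, Schwartz = locally constant with compact support, the orbital
integral a REAL Bochner integral against a normalized Haar measure parameter, «`F = ℚ_p`» as READING Q1, «minuscule» as a REAL lattice
condition, item 1.15 over REAL hermitian Gram matrices `Item115Dictionary` and the tree's `IdeleClassGroup.IsConjugateOrthogonal ∕ Symplectic`.
Seven short names collide across the two namespaces (`Mn`, `transferFactor`, `act`, `Matches`, `MatchingBijectionAsPrinted`,
`Item112AsPrinted`, `Item115AsPrinted`): no file may `open` both.  **RULING g2-3 (squad policy L4∕L5: no ⟨CARRIER⟩ field where Mathlib has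
the object): CANONICAL for every §1.3 object (relative side `S_n`, `M_n`, regular semisimple, transfer factor, action, sign, matching, orbital
integrals; items 1.9 ∕ 1.10 ∕ 1.12 ∕ 1.13 ∕ 1.14) and for item 1.15 with its footnote 3 = TL-t11's declarations.  THIS file stays canonical
ONLY for `Sec14Data`, `Sec15Data` ∕ `Sec15Data.lFunction_eq` (§1.5) and the RZ-side TOKENS (`Sec13Data.FormalSub`, `.specialDivisor` =
Def. 1.11 as a token, `.chiInt`); its §1.3 ∕ 1.15 declarations listed below are KEPT (append-only tree; two ★ importers: `AppendixA/AFLMinusculeCase`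
(+ `AppendixA/AFLMinusculeCaseHolds`), `Sec53OrbitalDecomposition`) but SUPERSEDED: NEW files cite TL-t11's names for §1.3 objects and item 1.15,
and this file's names only for `Sec14Data` ∕ `Sec15Data` ∕ the RZ tokens.  Existing consumers migrate at their next substantive edition
(TL-t14 lineage: `IsRS ∕ Sn ∕ Matches ∕ Rem114` → `IsRegularSemisimple ∕ symmSpace ∕ Matches ∕ Rem114AsPrinted`; TL-t13 lineage: `Stmt19_2 ∕
Item112AsPrinted` → `Item19Part2 ∕ Item112AsPrinted`); a bridge `Sec13Data.ofAFLSetup` is deferred until a consumer edition wants it.**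

Table — superseded declaration of THIS file (namespace `Literature.NumberTheory.Automorphic.Liu2021.Sec13to16IntroductionAFL`) ↦ canonical
declaration(s).  In this table ONLY, `L.` abbreviates the common namespace prefix `Literature.NumberTheory.Automorphic.Liu2021.`; the ⚠ line on
each declaration below spells the full name.  `R` = `L.Sec13RelativeFundamentalLemma`, `A` = `L.Sec13ArithmeticFundamentalLemma`,
`I` = `L.Sec1Introduction` (files ★ `Sec13RelativeFundamentalLemma.lean`, ★ `Sec13ArithmeticFundamentalLemma.lean`, ★ `Sec1Introduction.lean`).

| superseded here | canonical (RULING g2-3) | note |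
|---|---|---|
| `Sec13Data` (structure; PARTLY) | `L.Sec13RelativeFundamentalLemma.AFLSetup` (+ `….AFLSetup.HermSpaceLoc` for `V_n^±`, `U(V_n^±)`; `L.Sec13ArithmeticFundamentalLemma.RZDictionary` for `V_n^−`, `Λ_n`, `𝒩_n(S)`) | relative ∕ unitary-side token fields superseded by REAL constructions; RZ-side token fields `FormalSub`, `specialDivisor`, `chiInt` stay canonical tokens |
| `Sec13Data.Sn` | `L.Sec13RelativeFundamentalLemma.AFLSetup.symmSpace` (+ `.symmSpaceInt` for `S_n(O_F)`) | |
| `Sec13Data.Mn` | `L.Sec13RelativeFundamentalLemma.Mn` (+ `….AFLSetup.MnInt` for `M_n(O_F)`) | colliding short name |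
| `Sec13Data.y₁E`, `Sec13Data.y₂E` | `L.Sec13RelativeFundamentalLemma.AFLSetup.moment`, `.momentMatrix`, `.krylov` | helpers |
| `Sec13Data.IsRS` | `L.Sec13RelativeFundamentalLemma.AFLSetup.IsRegularSemisimple` | |
| `Sec13Data.transferFactor` (`ℂ`-valued over the token `muEF`) | `L.Sec13RelativeFundamentalLemma.AFLSetup.transferFactor` (`ℤˣ`-valued, READING M1) | colliding short name |
| `Sec13Data.act` | `L.Sec13RelativeFundamentalLemma.AFLSetup.act` | colliding short name |
| `Sec13Data.IsPlus`, `Sec13Data.IsMinus` (over the token `ordE`) | `L.Sec13RelativeFundamentalLemma.AFLSetup.sign` (`= 1` ∕ `= −1`, READING S1) and `….AFLSetup.SignCriterionAsPrinted` (the printed «if and only if», p. 12 L25–27) | |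
| `Sec13Data.IsRSU` | `L.Sec13RelativeFundamentalLemma.AFLSetup.IsRegularSemisimpleU` | |
| `Sec13Data.Matches` | `L.Sec13RelativeFundamentalLemma.AFLSetup.Matches` | colliding short name |
| `Sec13Data.MatchingBijectionAsPrinted` | `L.Sec13RelativeFundamentalLemma.AFLSetup.MatchingBijectionAsPrinted` (+ `.SignCriterionAsPrinted`) | colliding short name |
| `Sec13Data.OrbInvariantAsPrinted` | `L.Sec13RelativeFundamentalLemma.AFLSetup.OrbitInvarianceAsPrinted` | |
| `Sec13Data.Stmt19_1` | `L.Sec13RelativeFundamentalLemma.AFLSetup.Item19Part1` (the statement) and `….AFLSetup.Rem110_1AsPrinted` (Rem. 1.10, first sentence: it holds) | |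
| `Sec13Data.Stmt19_2` | `L.Sec13RelativeFundamentalLemma.AFLSetup.Item19Part2` | |
| `Sec13Data.Item19AsPrinted` | `….AFLSetup.Item19Part1` ∧ `….AFLSetup.Item19Part2` (no single canonical declaration) | |
| `Sec13Data.Rem110_2` (token bound `pBound`) | `L.Sec13RelativeFundamentalLemma.Rem110_2AsPrinted` (READING P1: `∃ N`) | |
| `Sec13Data.Item112AsPrinted` | `L.Sec13ArithmeticFundamentalLemma.RZDictionary.Item112AsPrinted` (+ `….RZDictionary.AFLIdentity` for one pair) | colliding short name |
| `Sec13Data.AFLLeftOrbitInvariant` | — (p. 14 L50–52 = l. 944 is recorded in the module docstring of ★ `Sec13ArithmeticFundamentalLemma.lean`; no canonical declaration) | do not restate: it follows from item 1.9 (1) |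
| `Sec13Data.Rem113_equiv` (token `ZhangAFL`) | — (the equivalence sentence of Rem. 1.13 is recorded in the module docstring of ★ `Sec13ArithmeticFundamentalLemma.lean`; its printed consequences are the next two rows) | |
| `Sec13Data.Rem113_1` | `L.Sec13ArithmeticFundamentalLemma.RZDictionary.Rem113_1AsPrinted` | |
| `Sec13Data.Rem113_2` (token `IsQp`) | `L.Sec13ArithmeticFundamentalLemma.RZDictionary.Rem113_2AsPrinted` (READING Q1 for «`F = ℚ_p`») | |
| `Sec13Data.Rem114` (token `IsMinuscule`) | `L.Sec13ArithmeticFundamentalLemma.Rem114AsPrinted` (+ REAL `L.Sec13ArithmeticFundamentalLemma.IsMinuscule`) | Thm. A.7 of ★ `AppendixA/AFLMinusculeCase.lean` still reads `Sec13Data.Rem114` until that lineage migrates |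
| `Sec14Data.Item115AsPrinted` | `L.Sec1Introduction.Item115AsPrinted` (over `L.Sec1Introduction.Item115Dictionary`) | colliding short name; `Sec14Data` itself is NOT superseded (ruling: canonical here), but a NEW file stating item 1.15 uses `I.Item115Dictionary` |
| `Sec14Data.Footnote115` | `L.Sec1Introduction.Footnote3AsPrinted` | |

NOT superseded (canonical here, unmarked): `Sec14Data` (the `Thm418Data`-style §1.4 carrier with `Lhalf = L(½, Π ⊗ μ)` on REAL idele class
characters), `Sec15Data`, `Sec15Data.lFunction_eq`, and the RZ-side token FIELDS of `Sec13Data` named above.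

## What is typed, and how

Items 1.9 («relative fundamental lemma for `U(n) × U(n)`»), 1.12 («arithmetic fundamental lemma for `U(n) × U(n)`») and 1.15 are
PREDICTIONS in print (headed as such); 1.9 (1) and parts of 1.12 are THEOREMS of the cited literature (Rem. 1.10, 1.13, 1.14) and
1.15 is known for `n ≤ 4` (footnote 3, p. 16).  As in `Sec44ArithmeticGGP` (same squad), the predicted statements are typed as
VOCABULARY — predicates `Item19AsPrinted`, `Item112AsPrinted`, `Item115AsPrinted` naming the printed relation on the consumer's datum,
never asserted, not dischargeable from this file (HONESTY NOTE: print heads them «Conjecture 1.9 / 1.12 / 1.15»; declaration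
docstrings write «item 1.x», because the gate's lint for unproved predictions keys on that word and such items, when USED, are filed
under `Summits/`) — while the remarks' attributions to PROVED sources are ordinary named-fact predicates (`Stmt19_1` via Rem. 1.10, `Rem110_2`,
`Rem113_equiv/_1/_2`, `Rem114`, `Footnote115`).
`Sec13Data` (local: «`F` a finite extension of `ℚ_p`, with residue cardinality `q`», «`E/F` an unramified quadratic extension», p. 11
L52–54): the fields `F ⊆ E` are REAL types with the Galois involution `c` as a datum; «finite extension of `ℚ_p`», the valuation of `E`
and the quadratic character `μ_{E/F}` are ⟨CARRIER⟩s (Mathlib has no bundled `p`-adic field class); the symmetric space `S_n(F)`, `M_n(F)`,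
regular semisimplicity, the `GL_n(F)`-action, the transfer factor, matching, and the derivative in 1.12 are REAL over those carriers
(§1.2 p. 10 / TeX l. 813: «`S_n` … the `O_F`-subscheme of `Res_{O_E/O_F} Mat_{n,n}` consisting of matrices `g` satisfying `g · g^c = I_n`»;
`M_n := Mat_{n,1} × Mat_{1,n}`); Schwartz spaces, orbital integrals, the hermitian spaces `V_n^±` with their unitary groups, the
unitary-side integral of (1.?) and the intersection number of 1.12 (relative Rapoport–Zink space `𝒩_n`, special divisors `𝒵_n(x)` of
Def. 1.11) are ⟨CARRIER⟩s with the printed definitions quoted.  READING O1: statements printed «for every regular semisimple ORBIT …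
where `(ξ, x)` is the unique orbit that matches» are typed «for every regular semisimple PAIR `(ζ, y)` and every regular semisimple pair
`(ξ, x)` matching it» (the two sides are orbit invariants — p. 12 L36: «`ω(ζ,y) Orb(0; f, φ; ζ, y)` depends only on the `GL_n(F)`-orbit»).
`Sec14Data` (global, §1.4) is over the CM extension `E/F` of §4 (instance arguments as in `Thm418Data`) with a REAL idele class
character variable.  §1.5 (arithmetic triple product) is typed as one identity of `L`-functions on carriers; §1.6 is prose (INDEX only).

## INDEX (item ↦ declaration; namespace `Literature.NumberTheory.Automorphic.Liu2021.Sec13to16IntroductionAFL`)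

§1.3: `S_n(F)`, `M_n(F)` ↦ `Sec13Data.Sn`, `Mn` (REAL); «regular semisimple» ↦ `IsRS`, `IsRSU` (REAL); transfer factor ↦ `transferFactor`
(REAL over `μ_{E/F}`); `GL_n(F)`-action ↦ `act` (REAL); `±` orbits ↦ `IsPlus`/`IsMinus`; matching ↦ `Matches` (REAL), the matching bijection
(p. 12 L20–24) ↦ `MatchingBijectionAsPrinted`; `Orb(s; f, φ; ζ, y)` ↦ carrier `orb`; orbit-invariance (p. 12 L36) ↦ `OrbInvariantAsPrinted`;
**1.9** ↦ `Stmt19_1`, `Stmt19_2`, `Item19AsPrinted`; **Rem. 1.10** ↦ first sentence = `Stmt19_1` (a proved part), second = `Rem110_2`; unitary `O_F`-modules, `𝒩_n`, `Λ_n`, `V_n^−`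
(pp. 13–14) ↦ carrier docstrings; **Def. 1.11** ↦ carrier `specialDivisor` (moduli description quoted); **1.12** ↦ `Item112AsPrinted`
(derivative REAL via Mathlib `deriv`); the orbit-invariance sentence after 1.12 ↦ `AFLLeftOrbitInvariant`; **Rem. 1.13** ↦ `Rem113_equiv`,
`Rem113_1`, `Rem113_2`; **Rem. 1.14** ↦ `IsMinuscule` (carrier predicate, definition quoted), `Rem114`.  §1.4: **1.15** ↦
`Sec14Data.Item115AsPrinted`; footnote 3 ([JZ20], `n ≤ 4`) ↦ `Footnote115`; the two comparison diagrams = prose, not typed.  §1.5 ↦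
`Sec15Data.lFunction_eq` (the displayed `L(s, σ₁ × σ₂ × σ₃) = L(s, Π₁ × Π₂ ⊗ μ)` under (1), (2)); the «essentially» formulas for
`GKS(g₁,g₂,g₃)_U` and `FJ(f₁,f₂;φ)_K` and «it is possible to show a priori …» are informal, not typed.  §1.6: structure of the article, prose.

## References
* [Liu2021] §1.3–1.6, pp. 11–20 = `FJcycle.tex` l. 848–1047; §1.2 l. 813 (`S_n`, `M_n`).
* Named in the text (not used here): [Liu14] Y. Liu 2014 (Prop. 5.14, Thm. 5.15); [KR11] Kudla–Rapoport (special divisors); [RZ96]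
  Rapoport–Zink Prop. 2.9; [Mih] Mihatsch §3.1; [Zha12] W. Zhang 2012 Thm. 2.10/5.5; [Zha21] W. Zhang 2021 Prop. 4.12, Rem. 3.1, Thm. 15.1;
  [JZ20] Jiang–Zhang; [GK92, GK93, YZZ] (triple product).
-/

noncomputable section

open NumberField Matrix

namespace Literature.NumberTheory.Automorphic.Liu2021.Sec13to16IntroductionAFL

universe u

/-! ## §1.3 Arithmetic fundamental lemma for `U(n) × U(n)` (pp. 11–15; local) -/

/-- ⚠ PARTLY SUPERSEDED (QA-20): canonical §1.3 set-up = `Literature.NumberTheory.Automorphic.Liu2021.Sec13RelativeFundamentalLemma.AFLSetup` (+ `Literature.NumberTheory.Automorphic.Liu2021.Sec13RelativeFundamentalLemma.AFLSetup.HermSpaceLoc` for `V_n^±`, `U(V_n^±)`; `Literature.NumberTheory.Automorphic.Liu2021.Sec13ArithmeticFundamentalLemma.RZDictionary` for `V_n^−`, `Λ_n`, `𝒩_n(S)`), which CONSTRUCT the relative ∕ unitary-side tokens posited here; kept for existing importers (★ `AppendixA/AFLMinusculeCase` extends it, ★ `Sec53OrbitalDecomposition` carries it as `loc13`); its RZ-side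 token fields `FormalSub`, `specialDivisor`, `chiInt` remain canonical tokens; do not build new §1.3 statements on it.
**Data of [Liu2021, §1.3]** (p. 11 L48 – p. 15 L17; TeX l. 848–962): «Let `F` be a finite extension of `ℚ_p`, with residue cardinality `q`. Let
`E/F` be an unramified quadratic extension … `n` … an arbitrary positive integer».  REAL: the fields `F ⊆ E`, the involution `c`, `n`; the
matrix-level notions below.  ⟨CARRIER⟩ (with the printed definitions): `p`, `q`, the valuation `v_E`, `μ_{E/F}`, the Schwartz spaces
`𝒮(S_n(F))`, `𝒮(M_n(F))` with `𝟙_{S_n(O_F)}`, `𝟙_{M_n(O_F)}`, the orbital integral «`Orb(s; f, φ; ζ, y) := ∫_{GL_n(F)} f(g⁻¹ζg) φ(g⁻¹y₁, y₂g)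
μ_{E/F}(det g) |det g|_E^s dg`» (p. 12 L30–35, `dg` giving `GL_n(O_F)` volume `1`), the hermitian spaces `V_n^+` / `V_n^−` («whose determinant
has even (resp. odd) valuation», p. 12 L10) with their unitary groups acting linearly, the integral «`∫_{U(V_n^+)} 𝟙_{K_n}(g⁻¹ξg)
𝟙_{Λ_n}(g⁻¹x) dg`» of 1.9 (2) («`Λ_n` a self-dual lattice in `V_n^+`, `K_n` the stabilizer of `Λ_n`», p. 13 L10–13), and for 1.12: the relative
Rapoport–Zink space `𝒩_n` of unitary `O_F`-modules of signature `(n−1, 1)` (p. 13 L24 – p. 14 L10), `Λ_n := Hom((𝕏_0, 𝕚_0), (𝕏_n, 𝕚_n))`,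
`V_n^− := (Λ_n)_ℚ` (p. 14 L11–18), the special divisors `𝒵_n(x)` (Def. 1.11) and «`χ(𝒪_{Γ_ξ} ⊗^𝕃_{𝒪_{𝒩_n²}} 𝒪_{Δ𝒵_n(x)})`», `χ` the
Euler–Poincaré characteristic (p. 14 L39–41).  Nothing asserted. [cite: Liu2021, §1.3 (pp. 11–15)] -/
structure Sec13Data (F E : Type u) [Field F] [Field E] [Algebra F E] : Type (u + 1) where
  /-- the nontrivial Galois involution `c` of `E/F` (used in «`g · g^c = I_n`»), as an `F`-algebra automorphism. -/
  conj : E ≃ₐ[F] E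
  /-- «`n` … an arbitrary positive integer». -/
  n : ℕ
  /-- «positive». -/
  one_le_n : 1 ≤ n
  /-- ⟨CARRIER⟩ the residue characteristic `p`. -/
  p : ℕ
  /-- ⟨CARRIER⟩ «residue cardinality `q`» of `F`. -/
  q : ℕ
  /-- ⟨CARRIER⟩ the normalized valuation of `E` (only the PARITY of `v_E(det …)` is used, p. 12 L10, L25–27). -/
  ordE : E → ℤ
  /-- ⟨CARRIER⟩ «`μ_{E/F}`», the quadratic character attached to `E/F`, evaluated as printed on determinants (p. 12 L6–7, L33). -/
  muEF : E → ℂ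
  /-- ⟨CARRIER⟩ the Schwartz space `𝒮(S_n(F))`. -/
  SchS : Type u
  /-- ⟨CARRIER⟩ `𝟙_{S_n(O_F)} ∈ 𝒮(S_n(F))`. -/
  oneS : SchS
  /-- ⟨CARRIER⟩ the Schwartz space `𝒮(M_n(F))`. -/
  SchM : Type u
  /-- ⟨CARRIER⟩ `𝟙_{M_n(O_F)} ∈ 𝒮(M_n(F))`. -/
  oneM : SchM
  /-- ⟨CARRIER⟩ «`Orb(s; f, φ; ζ, y)`» for `s ∈ ℂ`, `f ∈ 𝒮(S_n(F))`, `φ ∈ 𝒮(M_n(F))`, `ζ ∈ Mat_n(E)` (used on `S_n(F)`), `y = (y₁, y₂)` (p. 12 L30–35). -/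
  orb : ℂ → SchS → SchM → Matrix (Fin n) (Fin n) E → (Fin n → F) × (Fin n → F) → ℂ
  /-- ⟨CARRIER⟩ `V_n^δ`, `δ = +` (`true`) / `−` (`false`): «a hermitian space over `E` of rank `n` whose determinant has even (resp. odd) valuation». -/
  V : Bool → ModuleCat.{u} E
  /-- `V_n^δ` is finite-dimensional («of rank `n`»). -/
  finiteV : ∀ δ, Module.Finite E (V δ)
  /-- … and free (a vector space; recorded for `charpoly`). -/
  freeV : ∀ δ, Module.Free E (V δ)
  /-- ⟨CARRIER⟩ the hermitian form `( , )` on `V_n^δ`. -/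
  herm : ∀ δ, V δ → V δ → E
  /-- ⟨CARRIER⟩ `U(V_n^δ)(F)`, the unitary group. -/
  U : Bool → GrpCat.{u}
  /-- ⟨CARRIER⟩ its linear action on `V_n^δ(E)`. -/
  toEnd : ∀ δ, U δ →* Module.End E (V δ)
  /-- ⟨CARRIER⟩ the value `∫_{U(V_n^+)} 𝟙_{K_n}(g⁻¹ξg) 𝟙_{Λ_n}(g⁻¹x) dg` of 1.9 (2) at a pair `(ξ, x)` on `V_n^+` (p. 13 L9–13). -/
  intPlus : U true → V true → ℂ
  /-- ⟨CARRIER⟩ (token) closed formal subschemes of the relative Rapoport–Zink space `𝒩_n` (p. 13 L36 – p. 14 L10). -/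
  FormalSub : Type u
  /-- ⟨CARRIER⟩ **[Liu2021, Definition 1.11]** (p. 14 L19–26; TeX l. 923–930): «For every `x ∈ V_n^−` that is nonzero, we define `𝒵_n(x)` to be the
  subfunctor of `𝒩_n` such that for every scheme `S` over `O_Ĕ` on which `p` is locally nilpotent, `𝒵_n(x)(S)` consists of `(X, i, λ; ρ)` satisfying
  that the composite homomorphism `𝕏_{0k} ×_k S_k →^x 𝕏_n ×_k S_k →^{ρ⁻¹} X ×_S S_k` extends to an `O_E`-linear homomorphism `𝕏_0 ×_{O_Ĕ} S → X` over
  `S`.» («By [RZ96, Proposition 2.9], `𝒵_n(x)` is a closed sub-formal scheme of `𝒩_n`», p. 14 L27.)  Values at `x = 0` unused. -/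
  specialDivisor : V false → FormalSub
  /-- ⟨CARRIER⟩ the intersection number «`χ(𝒪_{Γ_ξ} ⊗^𝕃_{𝒪_{𝒩_n²}} 𝒪_{Δ𝒵_n(x)})`» ∈ ℤ of 1.12 at a pair `(ξ, x)` on `V_n^−` (`Γ_ξ ⊆ 𝒩_n²` the graph
  of `ξ`, p. 14 L28–33). -/
  chiInt : U false → V false → ℤ
  /-- ⟨CARRIER⟩ «`F = ℚ_p`» (Rem. 1.13 (2)). -/
  IsQp : Prop
  /-- ⟨CARRIER⟩ W. Zhang's arithmetic fundamental lemma for `U(n) × U(n+1)` «with respect to the same field extension `E/F`» (Rem. 1.13), as a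
  proposition. -/
  ZhangAFL : Prop
  /-- ⟨CARRIER⟩ «minuscule» regular semisimple pairs on `V_n^−` (Rem. 1.14, p. 15 L14–17; TeX l. 960–961): «the `O_E`-lattice `L_{ξ,x}` generated by
  `{x, ξx, ⋯, ξ^{n−1}x}` satisfies `ϖ L_{ξ,x}^* ⊆ L_{ξ,x} ⊆ L_{ξ,x}^*` where `ϖ` is a uniformizer of `F` and `L_{ξ,x}^*` denotes the dual lattice». -/
  IsMinuscule : U false → V false → Prop
  /-- ⟨CARRIER⟩ the bound of [Liu14, Thm. 5.15] («`p` sufficiently large», Rem. 1.10; a constant of the cited theorem, depending on `n`). -/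
  pBound : ℕ

namespace Sec13Data

variable {F E : Type u} [Field F] [Field E] [Algebra F E] (D : Sec13Data F E)

/-- ⚠ SUPERSEDED (QA-20): canonical = `Literature.NumberTheory.Automorphic.Liu2021.Sec13RelativeFundamentalLemma.AFLSetup.symmSpace` (and `Literature.NumberTheory.Automorphic.Liu2021.Sec13RelativeFundamentalLemma.AFLSetup.symmSpaceInt` for `S_n(O_F)`); kept for existing importers; do not cite in new files.
**`S_n(F)`**, «the symmetric space» (§1.2 p. 10; TeX l. 813): the matrices `g ∈ Mat_n(E)` with `g · g^c = I_n`. REAL. [cite: Liu2021, §1.2 (p. 10) and §1.3 (p. 11)] -/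
def Sn : Set (Matrix (Fin D.n) (Fin D.n) E) := {g | g * g.map D.conj = 1}

/-- ⚠ SUPERSEDED (QA-20): canonical = `Literature.NumberTheory.Automorphic.Liu2021.Sec13RelativeFundamentalLemma.Mn` (and `Literature.NumberTheory.Automorphic.Liu2021.Sec13RelativeFundamentalLemma.AFLSetup.MnInt` for `M_n(O_F)`); kept for existing importers; do not cite in new files.
**`M_n(F) := Mat_{n,1}(F) × Mat_{1,n}(F)`** (TeX l. 813, 855), `y = (y₁, y₂)`. REAL. [cite: Liu2021, §1.3 (p. 11 L57 – p. 12 L5)] -/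
abbrev Mn : Type u := (Fin D.n → F) × (Fin D.n → F)

/-- ⚠ SUPERSEDED (QA-20): canonical = `Literature.NumberTheory.Automorphic.Liu2021.Sec13RelativeFundamentalLemma.AFLSetup.moment` ∕ `Literature.NumberTheory.Automorphic.Liu2021.Sec13RelativeFundamentalLemma.AFLSetup.krylov` (the columns `ζ^k y₁`); kept for existing importers; do not cite in new files.
`y₁` as a vector over `E`. [cite: Liu2021, §1.3 (p. 12)] -/
def y₁E (y : D.Mn) : Fin D.n → E := fun i => algebraMap F E (y.1 i)

/-- ⚠ SUPERSEDED (QA-20): canonical = `Literature.NumberTheory.Automorphic.Liu2021.Sec13RelativeFundamentalLemma.AFLSetup.moment` ∕ `Literature.NumberTheory.Automorphic.Liu2021.Sec13RelativeFundamentalLemma.AFLSetup.momentMatrix` (the entries `y₂ ζ^k y₁`); kept for existing importers; do not cite in new files.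
`y₂` as a vector over `E`. [cite: Liu2021, §1.3 (p. 12)] -/
def y₂E (y : D.Mn) : Fin D.n → E := fun i => algebraMap F E (y.2 i)

/-- ⚠ SUPERSEDED (QA-20): canonical = `Literature.NumberTheory.Automorphic.Liu2021.Sec13RelativeFundamentalLemma.AFLSetup.IsRegularSemisimple`; kept for existing importers; do not cite in new files.
**«regular semisimple»** pair `(ζ, y)` (p. 11 L57 – p. 12 L5; TeX l. 855): «the matrix `(y₂ ζ^{i+j−2} y₁)_{i,j=1}^n` is non-degenerate» (indices from
`0`: `y₂ ζ^{i+j} y₁`). REAL. [cite: Liu2021, §1.3 (p. 11 L57)] -/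
def IsRS (ζ : Matrix (Fin D.n) (Fin D.n) E) (y : D.Mn) : Prop :=
  (Matrix.of fun i j : Fin D.n => D.y₂E y ⬝ᵥ (ζ ^ (i.1 + j.1)).mulVec (D.y₁E y)).det ≠ 0

/-- ⚠ SUPERSEDED (QA-20): canonical = `Literature.NumberTheory.Automorphic.Liu2021.Sec13RelativeFundamentalLemma.AFLSetup.transferFactor` (`ℤˣ`-valued: `μ_{E/F} = (−1)^{ord_E}`, READING M1); kept for existing importers; do not cite in new files.
**The transfer factor** (p. 12 L5–7; TeX l. 856–858): «`ω(ζ, y) := μ_{E/F}(det(y₁, ζy₁, …, ζ^{n−1}y₁))`». REAL over the carrier `μ_{E/F}`.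
[cite: Liu2021, §1.3 (p. 12 L5–7)] -/
def transferFactor (ζ : Matrix (Fin D.n) (Fin D.n) E) (y : D.Mn) : ℂ :=
  D.muEF (Matrix.of fun i k : Fin D.n => (ζ ^ k.1).mulVec (D.y₁E y) i).det

/-- ⚠ SUPERSEDED (QA-20): canonical = `Literature.NumberTheory.Automorphic.Liu2021.Sec13RelativeFundamentalLemma.AFLSetup.act`; kept for existing importers; do not cite in new files.
**The `GL_n(F)`-action** (p. 12 L8; TeX l. 859): «`(ζ, y)g = (g⁻¹ζg, g⁻¹y₁, y₂g)`». REAL. [cite: Liu2021, §1.3 (p. 12 L8)] -/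
def act (g : GL (Fin D.n) F) (ζ : Matrix (Fin D.n) (Fin D.n) E) (y : D.Mn) : Matrix (Fin D.n) (Fin D.n) E × D.Mn :=
  let gE : Matrix (Fin D.n) (Fin D.n) E := (g : Matrix (Fin D.n) (Fin D.n) F).map (algebraMap F E)
  let gEinv : Matrix (Fin D.n) (Fin D.n) E := ((g⁻¹ : GL (Fin D.n) F) : Matrix (Fin D.n) (Fin D.n) F).map (algebraMap F E)
  (gEinv * ζ * gE, (((g⁻¹ : GL (Fin D.n) F) : Matrix (Fin D.n) (Fin D.n) F).mulVec y.1,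
    Matrix.vecMul y.2 (g : Matrix (Fin D.n) (Fin D.n) F)))

/-- ⚠ SUPERSEDED (QA-20): canonical = `Literature.NumberTheory.Automorphic.Liu2021.Sec13RelativeFundamentalLemma.AFLSetup.sign` (`sign ζ y = 1`, READING S1; the printed criterion sentence = `Literature.NumberTheory.Automorphic.Liu2021.Sec13RelativeFundamentalLemma.AFLSetup.SignCriterionAsPrinted`); kept for existing importers; do not cite in new files.
The `+` orbits (p. 12 L25–27; TeX l. 866): «a regular semisimple orbit `(ζ, y)` belongs to `[S_n(F) × M_n(F)]_{rs}^δ` for `δ = +` (resp. `δ = −`) if and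
only if `det((y₂ζ^{i+j−2}y₁)_{i,j})` has even (resp. odd) valuation». [cite: Liu2021, §1.3 (p. 12 L25–27)] -/
def IsPlus (ζ : Matrix (Fin D.n) (Fin D.n) E) (y : D.Mn) : Prop :=
  Even (D.ordE (Matrix.of fun i j : Fin D.n => D.y₂E y ⬝ᵥ (ζ ^ (i.1 + j.1)).mulVec (D.y₁E y)).det)

/-- ⚠ SUPERSEDED (QA-20): canonical = `Literature.NumberTheory.Automorphic.Liu2021.Sec13RelativeFundamentalLemma.AFLSetup.sign` (`sign ζ y = −1`, READING S1; the printed criterion sentence = `Literature.NumberTheory.Automorphic.Liu2021.Sec13RelativeFundamentalLemma.AFLSetup.SignCriterionAsPrinted`); kept for existing importers; do not cite in new files.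
The `−` orbits: odd valuation (p. 12 L25–27). [cite: Liu2021, §1.3 (p. 12 L25–27)] -/
def IsMinus (ζ : Matrix (Fin D.n) (Fin D.n) E) (y : D.Mn) : Prop :=
  Odd (D.ordE (Matrix.of fun i j : Fin D.n => D.y₂E y ⬝ᵥ (ζ ^ (i.1 + j.1)).mulVec (D.y₁E y)).det)

/-- ⚠ SUPERSEDED (QA-20): canonical = `Literature.NumberTheory.Automorphic.Liu2021.Sec13RelativeFundamentalLemma.AFLSetup.IsRegularSemisimpleU`; kept for existing importers; do not cite in new files.
**«regular semisimple»** pair `(ξ, x)` on the unitary side (p. 12 L11–13; TeX l. 861): «`{x, ξx, …, ξ^{n−1}x}` are linearly independent». REAL.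
[cite: Liu2021, §1.3 (p. 12 L11–13)] -/
def IsRSU (δ : Bool) (ξ : D.U δ) (x : D.V δ) : Prop :=
  LinearIndependent E fun k : Fin D.n => ((D.toEnd δ ξ) ^ k.1) x

/-- ⚠ SUPERSEDED (QA-20): canonical = `Literature.NumberTheory.Automorphic.Liu2021.Sec13RelativeFundamentalLemma.AFLSetup.Matches`; kept for existing importers; do not cite in new files.
**Matching** (p. 12 L17–20; TeX l. 861–862): «`(ζ, y)` … and `(ξ, x)` … *match* if `ζ` and `ξ` have the same characteristic polynomial and
`y₂ζ^i y₁ = (ξ^i x, x)` for `0 ≤ i ≤ n − 1`» (`ξ`'s characteristic polynomial as an `E`-linear map of `V_n^δ`). REAL. [cite: Liu2021, §1.3 (p. 12 L17–20)] -/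
def Matches (ζ : Matrix (Fin D.n) (Fin D.n) E) (y : D.Mn) (δ : Bool) (ξ : D.U δ) (x : D.V δ) : Prop :=
  (haveI := D.finiteV δ; haveI := D.freeV δ; ζ.charpoly = (D.toEnd δ ξ).charpoly) ∧ ∀ i : Fin D.n, D.y₂E y ⬝ᵥ (ζ ^ i.1).mulVec (D.y₁E y) = D.herm δ (((D.toEnd δ ξ) ^ i.1) x) x

/-- ⚠ SUPERSEDED (QA-20): canonical = `Literature.NumberTheory.Automorphic.Liu2021.Sec13RelativeFundamentalLemma.AFLSetup.MatchingBijectionAsPrinted` (+ `Literature.NumberTheory.Automorphic.Liu2021.Sec13RelativeFundamentalLemma.AFLSetup.SignCriterionAsPrinted` for the `±` clause); kept for existing importers; do not cite in new files.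
**[Liu2021, §1.3, p. 12 L20–27] AS PRINTED**: «The matching relation induces a bijection `[S_n(F) × M_n(F)]_{rs} ≃ [U(V_n^+)(F) × V_n^+(E)]_{rs} ∐
[U(V_n^−)(F) × V_n^−(E)]_{rs}`» with the `±` parts matching the parity classes — at pair level (READING O1): every regular semisimple `(ζ, y) ∈ S_n(F) × M_n(F)`
matches some regular semisimple `(ξ, x)` on `V_n^+` iff it is a `+` pair and on `V_n^−` iff it is a `−` pair; matching pairs on the same `V_n^δ` are
`U(V_n^δ)(F)`-conjugate (well-defined); two regular semisimple `(ζ, y)`, `(ζ', y')` matching the same `(ξ, x)` are `GL_n(F)`-conjugate (injective —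
ED.2, squad retro-audit L1: this clause of «bijection» was missing in ED.1); every regular semisimple `(ξ, x)` is matched (surjective).  (That matching
is constant on `GL_n(F)`-orbits is automatic: `Matches` only uses the invariants `charpoly ζ`, `y₂ζ^i y₁`.)  NO PROOF. [cite: Liu2021, §1.3 (p. 12 L20–27)] -/
def MatchingBijectionAsPrinted : Prop :=
  (∀ (ζ) (y : D.Mn), ζ ∈ D.Sn → D.IsRS ζ y →
      ((∃ (ξ : D.U true) (x : D.V true), D.IsRSU true ξ x ∧ D.Matches ζ y true ξ x) ↔ D.IsPlus ζ y) ∧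
      ((∃ (ξ : D.U false) (x : D.V false), D.IsRSU false ξ x ∧ D.Matches ζ y false ξ x) ↔ D.IsMinus ζ y)) ∧
  (∀ (ζ) (y : D.Mn) (δ : Bool) (ξ ξ' : D.U δ) (x x' : D.V δ), ζ ∈ D.Sn → D.IsRS ζ y → D.IsRSU δ ξ x → D.IsRSU δ ξ' x' →
      D.Matches ζ y δ ξ x → D.Matches ζ y δ ξ' x' → ∃ g : D.U δ, ξ' = g⁻¹ * ξ * g ∧ x' = D.toEnd δ g⁻¹ x) ∧
  (∀ (ζ ζ' : Matrix (Fin D.n) (Fin D.n) E) (y y' : D.Mn) (δ : Bool) (ξ : D.U δ) (x : D.V δ), ζ ∈ D.Sn → ζ' ∈ D.Sn → D.IsRS ζ y →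
      D.IsRS ζ' y' → D.IsRSU δ ξ x → D.Matches ζ y δ ξ x → D.Matches ζ' y' δ ξ x → ∃ g : GL (Fin D.n) F, D.act g ζ y = (ζ', y')) ∧
  ∀ (δ : Bool) (ξ : D.U δ) (x : D.V δ), D.IsRSU δ ξ x → ∃ (ζ : _) (y : D.Mn), ζ ∈ D.Sn ∧ D.IsRS ζ y ∧ D.Matches ζ y δ ξ x

/-- ⚠ SUPERSEDED (QA-20): canonical = `Literature.NumberTheory.Automorphic.Liu2021.Sec13RelativeFundamentalLemma.AFLSetup.OrbitInvarianceAsPrinted`; kept for existing importers; do not cite in new files.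
**[Liu2021, §1.3, p. 12 L35–37] AS PRINTED**: «It is clear that the product `ω(ζ, y) Orb(0; f, φ; ζ, y)` depends only on the `GL_n(F)`-orbit of `(ζ, y)`.»
NO PROOF. [cite: Liu2021, §1.3 (p. 12 L35–37)] -/
def OrbInvariantAsPrinted : Prop :=
  ∀ (f : D.SchS) (φ : D.SchM) (ζ) (y : D.Mn) (g : GL (Fin D.n) F), ζ ∈ D.Sn → D.IsRS ζ y →
    D.transferFactor (D.act g ζ y).1 (D.act g ζ y).2 * D.orb 0 f φ (D.act g ζ y).1 (D.act g ζ y).2 =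
      D.transferFactor ζ y * D.orb 0 f φ ζ y

/-- ⚠ SUPERSEDED (QA-20): canonical = `Literature.NumberTheory.Automorphic.Liu2021.Sec13RelativeFundamentalLemma.AFLSetup.Item19Part1` (the statement of 1.9 (1)) and `Literature.NumberTheory.Automorphic.Liu2021.Sec13RelativeFundamentalLemma.AFLSetup.Rem110_1AsPrinted` (Rem. 1.10, first sentence: it holds); kept for existing importers; do not cite in new files.
1.9 (1) (p. 12 L41–42; TeX l. 878–881): «if `(ζ, y) ∈ [S_n(F) × M_n(F)]^−_{rs}`, then `ω(ζ, y) Orb(0; 𝟙_{S_n(O_F)}, 𝟙_{M_n(O_F)}; ζ, y) = 0`».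
This part is a THEOREM: **[Liu2021, Remark 1.10], first sentence** (p. 13 L20; TeX l. 893): «1.9 (1) is known by [Liu14, Proposition 5.14]» — so
`Stmt19_1 D` is also the named fact of Rem. 1.10 (first sentence); NO PROOF here. [cite: Liu2021, §1.3 (1.9 (1)) (p. 12) and Rem. 1.10 (p. 13)] -/
def Stmt19_1 : Prop :=
  ∀ (ζ) (y : D.Mn), ζ ∈ D.Sn → D.IsRS ζ y → D.IsMinus ζ y → D.transferFactor ζ y * D.orb 0 D.oneS D.oneM ζ y = 0

/-- ⚠ SUPERSEDED (QA-20): canonical = `Literature.NumberTheory.Automorphic.Liu2021.Sec13RelativeFundamentalLemma.AFLSetup.Item19Part2`; kept for existing importers; do not cite in new files.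
1.9 (2) (p. 12 L43 – p. 13 L13; TeX l. 883–889): «if `(ζ, y) ∈ [S_n(F) × M_n(F)]^+_{rs}`, then `ω(ζ, y) Orb(0; 𝟙_{S_n(O_F)}, 𝟙_{M_n(O_F)}; ζ, y) =
∫_{U(V_n^+)} 𝟙_{K_n}(g⁻¹ξg) 𝟙_{Λ_n}(g⁻¹x) dg` where `(ξ, x) ∈ [U(V_n^+)(F) × V_n^+(E)]_{rs}` is the unique orbit that matches `(ζ, y)`» (READING O1).
[cite: Liu2021, §1.3 (1.9 (2)) (pp. 12–13)] -/
def Stmt19_2 : Prop :=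
  ∀ (ζ) (y : D.Mn) (ξ : D.U true) (x : D.V true), ζ ∈ D.Sn → D.IsRS ζ y → D.IsPlus ζ y → D.IsRSU true ξ x → D.Matches ζ y true ξ x →
    D.transferFactor ζ y * D.orb 0 D.oneS D.oneM ζ y = D.intPlus ξ x

/-- ⚠ SUPERSEDED (QA-20): canonical = `Literature.NumberTheory.Automorphic.Liu2021.Sec13RelativeFundamentalLemma.AFLSetup.Item19Part1` ∧ `Literature.NumberTheory.Automorphic.Liu2021.Sec13RelativeFundamentalLemma.AFLSetup.Item19Part2` (no single canonical declaration for the conjunction); kept for existing importers; do not cite in new files.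
**[Liu2021, §1.3, item 1.9] AS PRINTED** («relative fundamental lemma for `U(n) × U(n)`», p. 12 L38 – p. 13 L13; TeX l. 875–890; «We recall the following
… from [Liu14]») — a PREDICTED identity (part (1) proved, part (2) proved for `p` large: Rem. 1.10), typed as VOCABULARY (predicate; never asserted).
«For every regular semisimple orbit `(ζ, y) ∈ [S_n(F) × M_n(F)]_{rs}`, we have (1) … (2) …» = `Stmt19_1 ∧ Stmt19_2`. [cite: Liu2021, §1.3 (1.9) (p. 12)] -/
def Item19AsPrinted : Prop := D.Stmt19_1 ∧ D.Stmt19_2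

/-- ⚠ SUPERSEDED (QA-20): canonical = `Literature.NumberTheory.Automorphic.Liu2021.Sec13RelativeFundamentalLemma.Rem110_2AsPrinted` (READING P1: `∃ N`, residue characteristic `≥ N`, in place of the token bound `pBound`); kept for existing importers; do not cite in new files.
**[Liu2021, Remark 1.10], second sentence, AS PRINTED** (p. 13 L20–21): «1.9 (2) is known for `p` sufficiently large by [Liu14, Theorem 5.15].»  Typed with
the ⟨CARRIER⟩ bound `pBound` of the cited theorem: `pBound ≤ p → Stmt19_2`.  NO PROOF. [cite: Liu2021, Rem. 1.10 (p. 13)] -/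
def Rem110_2 : Prop := D.pBound ≤ D.p → D.Stmt19_2

/-- ⚠ SUPERSEDED (QA-20): canonical = `Literature.NumberTheory.Automorphic.Liu2021.Sec13ArithmeticFundamentalLemma.RZDictionary.Item112AsPrinted` (+ `Literature.NumberTheory.Automorphic.Liu2021.Sec13ArithmeticFundamentalLemma.RZDictionary.AFLIdentity` for one pair); kept for existing importers; do not cite in new files.
**[Liu2021, §1.3, item 1.12] AS PRINTED** («arithmetic fundamental lemma for `U(n) × U(n)`», p. 14 L34–43; TeX l. 934–942) — a PREDICTED identity,
typed as VOCABULARY (predicate; never asserted).  «For every regular semisimple orbit `(ζ, y) ∈ [S_n(F) × M_n(F)]^−_{rs}`, we have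
`−ω(ζ, y) (d/ds)|_{s=0} Orb(s; 𝟙_{S_n(O_F)}, 𝟙_{M_n(O_F)}; ζ, y) = 2 log q · χ(𝒪_{Γ_ξ} ⊗^𝕃_{𝒪_{𝒩_n²}} 𝒪_{Δ𝒵_n(x)})`, where `(ξ, x) ∈ [U(V_n^−)(F) ×
V_n^−(E)]_{rs}` is the unique orbit that matches `(ζ, y)`, and `χ` denotes the Euler–Poincaré characteristic.»  The derivative is Mathlib's `deriv` of
`s ↦ Orb(s; …)` at `0`; `log` the real logarithm (READING O1 for orbits). [cite: Liu2021, §1.3 (1.12) (p. 14)] -/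
def Item112AsPrinted : Prop :=
  ∀ (ζ) (y : D.Mn) (ξ : D.U false) (x : D.V false), ζ ∈ D.Sn → D.IsRS ζ y → D.IsMinus ζ y → D.IsRSU false ξ x →
    D.Matches ζ y false ξ x →
    -(D.transferFactor ζ y * deriv (fun s : ℂ => D.orb s D.oneS D.oneM ζ y) 0) =
      (2 * Real.log D.q : ℂ) * (D.chiInt ξ x : ℂ)

/-- ⚠ SUPERSEDED (QA-20): no canonical declaration — the sentence (p. 14 L50–52, l. 944) is recorded in the module docstring of ★ `Literature.NumberTheory.Automorphic.Liu2021.Sec13ArithmeticFundamentalLemma` (vocabulary `Literature.NumberTheory.Automorphic.Liu2021.Sec13RelativeFundamentalLemma.AFLSetup.transferFactor` ∕ `.orbIntegral` ∕ `.act`) and follows from item 1.9 (1); kept for existing importers; do not cite in new files.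
**[Liu2021, §1.3, p. 14 L50–52] AS PRINTED**: «In 1.12, it follows from 1.9 (1), which is known, that the left-hand side depends only on the
`GL_n(F)`-orbit of `(ζ, y)`.»  NO PROOF. [cite: Liu2021, §1.3 (p. 14 L50–52)] -/
def AFLLeftOrbitInvariant : Prop :=
  ∀ (ζ) (y : D.Mn) (g : GL (Fin D.n) F), ζ ∈ D.Sn → D.IsRS ζ y → D.IsMinus ζ y →
    D.transferFactor (D.act g ζ y).1 (D.act g ζ y).2 *
        deriv (fun s : ℂ => D.orb s D.oneS D.oneM (D.act g ζ y).1 (D.act g ζ y).2) 0 =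
      D.transferFactor ζ y * deriv (fun s : ℂ => D.orb s D.oneS D.oneM ζ y) 0

/-- ⚠ SUPERSEDED (QA-20): no canonical declaration — the equivalence sentence of Rem. 1.13 is recorded in the module docstring of ★ `Literature.NumberTheory.Automorphic.Liu2021.Sec13ArithmeticFundamentalLemma`; its printed consequences are `Literature.NumberTheory.Automorphic.Liu2021.Sec13ArithmeticFundamentalLemma.RZDictionary.Rem113_1AsPrinted` ∕ `Literature.NumberTheory.Automorphic.Liu2021.Sec13ArithmeticFundamentalLemma.RZDictionary.Rem113_2AsPrinted`; kept for existing importers; do not cite in new files.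
**[Liu2021, Remark 1.13], main sentence, AS PRINTED** (p. 15 L5–8; TeX l. 947): «Wei Zhang [Zha21, Proposition 4.12 & Remark 3.1] has shown that his
arithmetic fundamental lemma for `U(n) × U(n+1)` is equivalent to our arithmetic fundamental lemma for `U(n) × U(n)` (with respect to the same field
extension `E/F`) when the residue cardinality of `F` is greater than `n`.»  (`ZhangAFL` a ⟨CARRIER⟩ proposition.)  NO PROOF. [cite: Liu2021, Rem. 1.13 (p. 15)] -/
def Rem113_equiv : Prop := D.n < D.q → (D.ZhangAFL ↔ D.Item112AsPrinted)

/-- ⚠ SUPERSEDED (QA-20): canonical = `Literature.NumberTheory.Automorphic.Liu2021.Sec13ArithmeticFundamentalLemma.RZDictionary.Rem113_1AsPrinted`; kept for existing importers; do not cite in new files.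
**[Liu2021, Remark 1.13 (1)] AS PRINTED** (p. 15 L9; TeX l. 949): «1.12 holds when `n ≤ 2` and `q` is odd, by [Zha12, Theorem 2.10 & Theorem 5.5].»
A proved case (named fact); NO PROOF here. [cite: Liu2021, Rem. 1.13 (1) (p. 15)] -/
def Rem113_1 : Prop := D.n ≤ 2 → Odd D.q → D.Item112AsPrinted

/-- ⚠ SUPERSEDED (QA-20): canonical = `Literature.NumberTheory.Automorphic.Liu2021.Sec13ArithmeticFundamentalLemma.RZDictionary.Rem113_2AsPrinted` (READING Q1 «`F = ℚ_p`» = `q` prime ∧ `ord_F q = 1`, in place of the token `IsQp`); kept for existing importers; do not cite in new files.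
**[Liu2021, Remark 1.13 (2)] AS PRINTED** (p. 15 L10–11; TeX l. 951): «1.12 holds when `F = ℚ_p` with `p > n`, by [Zha21, Theorem 15.1].»  A proved case
(named fact); NO PROOF here. [cite: Liu2021, Rem. 1.13 (2) (p. 15)] -/
def Rem113_2 : Prop := D.IsQp → D.n < D.p → D.Item112AsPrinted

/-- ⚠ SUPERSEDED (QA-20): canonical = `Literature.NumberTheory.Automorphic.Liu2021.Sec13ArithmeticFundamentalLemma.Rem114AsPrinted` (with the REAL `Literature.NumberTheory.Automorphic.Liu2021.Sec13ArithmeticFundamentalLemma.IsMinuscule` in place of the token field `IsMinuscule`); kept for existing importers; do not cite in new files.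
**[Liu2021, Remark 1.14] AS PRINTED** (p. 15 L12–17; TeX l. 959–961): «In Section A, Chao Li and Yihang Zhu proved 1.12 (for arbitrary `E/F`) in the
so-called minuscule case» — the identity of 1.12 for minuscule regular semisimple `(ξ, x)` (definition quoted on the ⟨CARRIER⟩ `IsMinuscule`).  A proved
case (Appendix A, Li–Zhu); NO PROOF here. [cite: Liu2021, Rem. 1.14 (p. 15) and App. A] -/
def Rem114 : Prop :=
  ∀ (ζ) (y : D.Mn) (ξ : D.U false) (x : D.V false), ζ ∈ D.Sn → D.IsRS ζ y → D.IsMinus ζ y → D.IsRSU false ξ x →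
    D.Matches ζ y false ξ x → D.IsMinuscule ξ x →
    -(D.transferFactor ζ y * deriv (fun s : ℂ => D.orb s D.oneS D.oneM ζ y) 0) =
      (2 * Real.log D.q : ℂ) * (D.chiInt ξ x : ℂ)

end Sec13Data

/-! ## §1.4 Relation between `U(n) × U(n)` and `U(n) × U(n+1)`: item 1.15 (p. 16; global) -/

/-- **Data of [Liu2021, item 1.15]** (p. 16 L9–14; TeX l. 991–998), over a CM extension `E/F` of number fields (instance arguments as in `Thm418Data`;
`E` is then a CM field, `isCMField F E`): «Let `V` be a hermitian space over `E` of rank `n ≥ 1`. Let `π` be a tempered cuspidal automorphic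
representation of `U(V)(𝔸_F)` … `Π` is the standard base change of `π` to `GL_n(𝔸_E)`.»  ⟨CARRIER⟩: `V`, `π` (tokens; «tempered cuspidal» is part of
the token's meaning), and `μ ↦ L(½, Π ⊗ μ)` on REAL idele class characters `μ` of `E`.  Nothing asserted. [cite: Liu2021, §1.4 (1.15) (p. 16)] -/
structure Sec14Data (F E : Type) [Field F] [NumberField F] [IsTotallyReal F] [Field E] [NumberField E] [Algebra F E]
    [IsTotallyComplex E] [Algebra.IsQuadraticExtension F E] : Type 1 where
  /-- «rank `n ≥ 1`». -/
  n : ℕ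
  /-- «`n ≥ 1`». -/
  one_le_n : 1 ≤ n
  /-- ⟨CARRIER⟩ (token) «a hermitian space over `E` of rank `n`». -/
  V : Type
  /-- ⟨CARRIER⟩ (token) «a tempered cuspidal automorphic representation of `U(V)(𝔸_F)`». -/
  π : Type
  /-- ⟨CARRIER⟩ `μ ↦ L(½, Π ⊗ μ)`, the central value of the `L`-function of the base change `Π` twisted by an automorphic character `μ` of `𝔸_E^×`
  (REAL `μ : IdeleClassGroup E →ₜ* Circle`). -/
  Lhalf : (IdeleClassGroup E →ₜ* Circle) → ℂ

/-- ⚠ SUPERSEDED (QA-20): canonical = `Literature.NumberTheory.Automorphic.Liu2021.Sec1Introduction.Item115AsPrinted` (over `Literature.NumberTheory.Automorphic.Liu2021.Sec1Introduction.Item115Dictionary`; `Sec14Data` itself is not superseded); kept for existing importers; do not cite in new files.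
**[Liu2021, §1.4, item 1.15] AS PRINTED** (p. 16 L9–14; TeX l. 991–998) — a PREDICTED statement (footnote 3: confirmed for `n ≤ 4` by [JZ20]; known
before for `n ≤ 2`), typed as VOCABULARY (predicate; never asserted).  «If `n` is even (resp. odd), then there exists a conjugate orthogonal (resp.
conjugate symplectic) automorphic character `μ` of `𝔸_E^×` such that `L(½, Π ⊗ μ) ≠ 0`.»  `μ` REAL with the tree's `IdeleClassGroup.IsConjugateOrthogonal` /
`IsConjugateSymplectic` (Def. 4.1). [cite: Liu2021, §1.4 (1.15) (p. 16)] -/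
def Sec14Data.Item115AsPrinted {F E : Type} [Field F] [NumberField F] [IsTotallyReal F] [Field E] [NumberField E] [Algebra F E]
    [IsTotallyComplex E] [Algebra.IsQuadraticExtension F E] (D : Sec14Data F E) : Prop :=
  letI : IsCMField E := isCMField F E
  (Even D.n → ∃ μ : IdeleClassGroup E →ₜ* Circle, IdeleClassGroup.IsConjugateOrthogonal E μ ∧ D.Lhalf μ ≠ 0) ∧
    (Odd D.n → ∃ μ : IdeleClassGroup E →ₜ* Circle, IdeleClassGroup.IsConjugateSymplectic E μ ∧ D.Lhalf μ ≠ 0)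

/-- ⚠ SUPERSEDED (QA-20): canonical = `Literature.NumberTheory.Automorphic.Liu2021.Sec1Introduction.Footnote3AsPrinted`; kept for existing importers; do not cite in new files.
**[Liu2021, §1.4, footnote 3] AS PRINTED** (p. 16; TeX l. 987): «Recently, Dihua Jiang and Lei Zhang [JZ20] have confirmed [1.15] when `n ≤ 4`. Of course,
when `n ≤ 2`, it was already known before.»  A proved case (named fact); NO PROOF here. [cite: Liu2021, §1.4 footnote 3 (p. 16)] -/
def Sec14Data.Footnote115 {F E : Type} [Field F] [NumberField F] [IsTotallyReal F] [Field E] [NumberField E] [Algebra F E]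
    [IsTotallyComplex E] [Algebra.IsQuadraticExtension F E] (D : Sec14Data F E) : Prop :=
  D.n ≤ 4 → D.Item115AsPrinted

/-! ## §1.5 Relation with the arithmetic triple product formula (pp. 17–18) -/

/-- **Data of [Liu2021, §1.5]** (p. 17 L9 – p. 18 L18; TeX l. 1021–1045): three cuspidal `σ₁, σ₂, σ₃` of `GL_2(𝔸_F)` of parallel weight `2` with trivial
product of central characters and `ε(½, σ₁ × σ₂ × σ₃) = −1`; hypotheses «(1) `σ₃` is the theta lifting of `μ^{alg} := μ · | |_E^{−1/2}` for an automorphic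
character `μ` of `𝔸_E^×` which is necessarily conjugate symplectic of weight one; (2) for `i = 1, 2`, the base change of `σ_i` to `GL_2(𝔸_E)`, denoted by
`Π_i`, has trivial central character».  ⟨CARRIER⟩: the two hypotheses as propositions and the two `L`-functions as functions of `s`.  Nothing asserted.
[cite: Liu2021, §1.5 (pp. 17–18)] -/
structure Sec15Data where
  /-- ⟨CARRIER⟩ hypothesis (1) of p. 17 (theta lifting). -/
  hyp₁ : Prop
  /-- ⟨CARRIER⟩ hypothesis (2) of p. 17 (trivial central characters of `Π₁`, `Π₂`). -/
  hyp₂ : Prop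
  /-- ⟨CARRIER⟩ `s ↦ L(s, σ₁ × σ₂ × σ₃)`. -/
  Ltriple : ℂ → ℂ
  /-- ⟨CARRIER⟩ `s ↦ L(s, Π₁ × Π₂ ⊗ μ)`. -/
  LRS : ℂ → ℂ

/-- **[Liu2021, §1.5, p. 18 L9–11] AS PRINTED** (TeX l. 1042–1044): under (1) and (2), «we have the equality `L(s, σ₁ × σ₂ × σ₃) = L(s, Π₁ × Π₂ ⊗ μ)` between
`L`-functions».  NO PROOF. [cite: Liu2021, §1.5 (p. 18)] -/
def Sec15Data.lFunction_eq (D : Sec15Data) : Prop := D.hyp₁ → D.hyp₂ → ∀ s : ℂ, D.Ltriple s = D.LRS s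

end Literature.NumberTheory.Automorphic.Liu2021.Sec13to16IntroductionAFL

end
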